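import Summits.AtomisticToContinuum.FouriersLaw.Theses.BondHeatUncertainty

/-!
# Disproof of `SubdiffusiveBondHeat` — findings (crux disprover, generation 1, cycle 1)

Crux item `stmt-AtomisticToContinuum-9120` =
`Summit.AtomisticToContinuum.FouriersLaw.Theses.BondHeatUncertainty.SubdiffusiveBondHeat` (S), rank 2 of route
BondHeatUncertainty: for `P = pinnedChain ω₂ lam β γ` (all four `> 0`) and `T > 0`, with
`C_N(b,s) = ∫ j_b · (P_s j_b) dμ_T^N` (constructed `transitionKernel` at equal bath temperatures, `gibbsMeasure`) and
`V_N(b,t) = 2∫₀ᵗ (t−s) C_N(b,s) ds` (the equilibrium variance of the heat `Q_t^(b) = ∫₀ᵗ j_b` through bond `(b,b+1)`):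
`∃ A c > 0, N₀ ∀ N ≥ N₀ ∃ b (b+1<N) ∀ t ∈ [1, cN²], V_N(b,t) ≤ A√t` — the Edwards–Wilkinson ¼-law of the single-bond
heat up to the Thouless time.

VERDICT (cycle 1, 2026-08-16): **RESISTS every cheap attack; a kill = superdiffusive equilibrium energy spreading
(or non-Ohmic conductance) in a pinned, doubly anharmonic chain, for which no mechanism is in print and of which this
seat's MD to N = 512 shows no trace (conductance saturating at κ(T=1) ≈ 21, `V/√t|_{t=N²/16}` saturating).**  Summary of
what this file establishes (prose only in docstrings; `sorry` only in §5):

* §0 `crux_iff` — read-back in named pieces (`bondCorr`, `bondHeatVar`, `WindowLaw`), `Iff.rfl` with the route decl.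
* §1 JUNK AUDIT (`windowLaw_of_vanishing`, `windowLaw_of_diffusive_ohmic`): every Bochner / interval-integral junk
  default in (S) evaluates to `0` and makes (S) EASIER (`V ≡ 0` satisfies it with `A = 0`); the objects are honest
  (kernel = law of the pathwise SDE flow, `pinnedChain_transitionKernel_apply`; Gibbs = `volume.tilted (-H/T)`), so
  there is NO junk lever for a refuter and NO vacuity lever for a prover (`C_N` is measurable and `|C_N(b,s)| ≤ ‖j_b‖²₂`
  once Gibbs-invariance of the kernels is proved — BoundaryEscapeDeficit.BoundaryKernelBasics(a)).  The shape lemma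
  `windowLaw_of_diffusive_ohmic` records that the expected physical form `V ≤ a√t + B·t/N` (EW law + Kubo–KDN
  saturation `2T²G_N t`, `G_N ≍ κ/N`) gives (S) for EVERY `c > 0` with `A = a + B√c`: the window is not where (S)
  can fail.
* §2 LOAD-BEARING ANALYSIS (docstring `loadBearing` + defs): `0 < lam ∧ 0 < β` (anharmonicity) is load-bearing —
  at `lam = β = 0` (S) is FALSE (ballistic phonons: `V_N(b,t) ≍ t` from `t = O(1)` on; exact Gaussian computation,
  kit j007955, and `HarmonicChainBallisticFlux_holds`): `false_without_anharmonicity` (§5, modulo the one `sorry`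
  `not_harmonicWindowLaw` — the Gaussian two-time calculus of the harmonic SDE is not in tree).  NOT load-bearing for
  truth: `0 < γ` (at `γ = 0` the boundary bond `b = N−2` gives `∫₀ᵗ j_{N−2} = Δe_{N−1}` pathwise, so
  `V ≤ 4·sup_N Var_{μ_T^N}(e_{N−1}) = O(1)` — the `∃ b` lets the prover sit next to a bath or a free end; with
  `γ > 0` the same choice is the lead's line `bath-bond-deficit-integral`), `0 < ω₂` (quartic pinning alone pins; only
  the tree's flow/measurability lemmas use `ω₂ > 0`), each of `0 < lam`, `0 < β` SEPARATELY (pinned FPU-β and the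
  φ⁴-type chain are both expected diffusive).  Quantifier audit: `A, c, N₀` may depend on `(ω₂,lam,β,γ,T)` (∃ after
  ∀T) — necessary: `A(T) ≳ T²·√τ(T)` with the phonon mean free time `τ(T) → ∞` as `T → 0`
  (`LowTemperatureWeakAnharmonicity`), and `A(T) → ∞` as `T → ∞` (`⟨j_b²⟩_T → ∞`).
* §3 TIGHTNESS OF THE WINDOW, both directions, sorry-free — LANDED as
  `Summits/AtomisticToContinuum/FouriersLaw/Theorems/SubdiffusiveBondHeat/Negative/WindowThreshold.lean` (p72842,
  commit 476619540504; decls `…Negative.WindowThreshold.transfer_fails_below_thouless`, `transfer_of_two_le`,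
  `not_window_cube_of_ohmicFloor`, `window_of_diffusive_ohmic`, `subdiffusiveBondHeat_of_diffusive_ohmic`):
  (a) `transferSchema_iff : TransferSchema α ↔ 2 ≤ α` — the route's transfer ((S_α) ∧ (K) ∧ (★) ⇒ bounded `N·G_N`),
  abstracted over the data, holds EXACTLY from the Thouless exponent on; below it the saturating model
  `G_N = N^{1/2−3α/4}`, `K_N = N`, `V = 2G²t²/(Gt+K)` obeys every hypothesis with `N·G_N = N^{3(2−α)/4} → ∞`.  So the
  light-cone rung (`α = 1`) can never give bounded response through (★)+(K) (its `G_N = O(N^{-1/4})` is optimal for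
  the schema), and no repair of (S) with a sub-Thouless window serves `TransferToBoundedResponse`.
  (b) `not_windowLaw_cube_of_ohmicFloor` — conversely, given an Ohmic FLOOR `V_N(b,t) ≥ g·t/N` for `t ≥ N²`
  (Kubo–KDN saturation with `G_N ≳ κ/N`, the positive half of Fourier's law), the window law with window `cN³` is
  false: the crux's exponent 2 is maximal.  (S) sits exactly at the crossover; it cannot be cheaply strengthened or
  weakened in the window.
* §4 TARGETS: none yet (`payload.targets = []`).  Pre-attack of the lead's five ACTIVE stubs (skeleton 47d1b61f, line
  `bath-bond-deficit-integral`, `b = 0`) in docstring `stubsPreAttack`: all five are true in the model; the identity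
  `Var(Q^L_t) = 2γT²∫₀ᵗ(1−θ_N)` behind `stub_bathBondReduction` re-derived independently here (reversal sign
  `E[θ₀(z_s)Q^L_s] = +γ∫₀ˢK_N` ✓); junk trap recorded: `stub_ohmicFloor`/`stub_transientEW` use the Bochner integral
  `∫_{Ioi 0} K_N`, honest only once `K_N ∈ L¹(0,∞)` at fixed `N` — available from `pinnedChainSemigroup_exp_convergence`
  (CEHR Thm 2.13(3), PROVED in tree) with `|θ₀| ≤ C_ϑ e^{ϑH}`; without it `E_N = 1` and `stub_ohmicFloor` is false as
  typed.  `stub_gibbsMomentumFourthMoment` holds with EQUALITY (`E p₀⁴ = 3T²`, Gaussian marginal) — no slack.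
  `ohmicFloor_necessary_at_bathBond` (sorry-free, abstract): (S)|_{b=0} + the reverse reduction + a nonnegative
  transient FORCE `E_N = O(1/N)` — `stub_ohmicFloor` cannot be evaded by any line sitting at the bath bond.
  CALIBRATION CORRECTION (exact, local): at the harmonic member `stub_transientEW` FAILS too (deficit plateau
  `0.14825` above `E_∞ = 0.125` until the first echo at `≈ 3.2N` ⇒ `∫transient ≈ 1.2 + 0.0233t` ⇒ ratio to `√t` at
  `t = 3N` grows like `0.04√N`), contrary to the line card; invisible below `N ≈ 600`.
* §5 NEAR-MISS (the one `sorry`): `not_harmonicWindowLaw` — (S) at `lam = β = 0` is false: EXACT local Gaussian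
  computation gives the bulk-bond plateau `V_∞(t) = 0.390·t` (bath bond `0.300·t`) at `(ω₂,γ,T) = (1,1,1)` inside
  the light cone and `V/t ↘ 2T²G_N = 0.25` beyond; obstruction to a Lean proof = no Gaussian-process / Isserlis
  calculus for `transitionKernel` of the linear chain in tree (only the NESS flux, `HarmonicChainBallisticFlux_holds`).
* §6 NUMERICS (docstring `numerics`): kit j007947 DONE (equilibrium MD, pinnedChain 1 1 1 1, T ∈ {1, 0.1, 5},
  N = 32…512, harmonic controls): NO ANOMALY — at T = 1 the response `D_N ≈ N·G_N` = 5.2, 8.5, 15, 20, ≈ 21 for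
  N = 32…512 SATURATES at `κ ≈ 21 ± 2` (Ohmic beyond N ≈ 500; crossover length ≈ 100–150), and `V/√t` at
  `t = N²/16` = 3.2, 5.1, 8.0, 10.5, 13.1 decelerates (×1.59, 1.57, 1.31, 1.25 per doubling) towards
  `a + 2√c·κ ≈ 14`, exactly the `a√t + 2T²G_N t` shape of §1; (S) numerically SUPPORTED with `A(1/16) ≈ 14–15`,
  `N₀ ≈ 500` at T = 1; harmonic controls reproduce the exact §5 numbers.  j007955 (exact harmonic, N ≤ 256) still
  queued — superseded by the local exact runs.
* §7 WHY IT RESISTS (docstring `whyItResists`).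
-/

noncomputable section

open MeasureTheory Filter Topology Set
open Literature.MathematicalPhysics.KineticTheory.HeatConduction

namespace Summit.AtomisticToContinuum.FouriersLaw.Cruxes.SubdiffusiveBondHeat.Disproof

open Summit.AtomisticToContinuum.FouriersLaw.Theses.BondHeatUncertainty

/-! ## §0 Read-back of the crux in named pieces -/

/-- `C_N(b,s) = ∫ j_b(z) · (P_s j_b)(z) dμ_T^N(z)` — the crux's `let C`, parameters exposed (junk `0` for `b ≥ N`). -/
def bondCorr (ω₂ lam β γ T : ℝ) (N b : ℕ) (s : ℝ) : ℝ :=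
  if h : b < N then
    ∫ z, (pinnedChain ω₂ lam β γ).bondCurrent N ⟨b, h⟩ z *
        (∫ y, (pinnedChain ω₂ lam β γ).bondCurrent N ⟨b, h⟩ y
          ∂((pinnedChain ω₂ lam β γ).transitionKernel N T T s.toNNReal z))
      ∂((pinnedChain ω₂ lam β γ).gibbsMeasure N T)
  else 0

/-- `V_N(b,t) = 2∫₀ᵗ (t−s) C_N(b,s) ds` — the crux's `let V` (equilibrium bond-heat variance). -/
def bondHeatVar (ω₂ lam β γ T : ℝ) (N b : ℕ) (t : ℝ) : ℝ :=
  2 * ∫ s in (0 : ℝ)..t, (t - s) * bondCorr ω₂ lam β γ T N b s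

/-- The window law for an abstract variance functional `V` and window-length map `L c N`:
`∃ A c > 0, N₀ ∀ N ≥ N₀ ∃ b (b+1<N) ∀ t ∈ [1, L c N], V N b t ≤ A√t`. -/
def WindowLaw (V : ℕ → ℕ → ℝ → ℝ) (L : ℝ → ℕ → ℝ) : Prop :=
  ∃ A c : ℝ, 0 < c ∧ ∃ N₀ : ℕ, ∀ N : ℕ, N₀ ≤ N → ∃ b : ℕ, b + 1 < N ∧
    ∀ t : ℝ, 1 ≤ t → t ≤ L c N → V N b t ≤ A * Real.sqrt t

/-- The Thouless window `c·N²` of the crux. -/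
def thouless : ℝ → ℕ → ℝ := fun c N => c * (N : ℝ) ^ 2

/-- The light-cone window `a·N` of the support item `LightConeBondHeat`. -/
def lightCone : ℝ → ℕ → ℝ := fun a N => a * (N : ℝ)

/-- Read-back: the crux is the Thouless-window law of `bondHeatVar`, for all admissible parameters. -/
theorem crux_iff :
    SubdiffusiveBondHeat ↔
      ∀ ω₂ lam β γ : ℝ, 0 < ω₂ → 0 < lam → 0 < β → 0 < γ → ∀ T : ℝ, 0 < T →
        WindowLaw (bondHeatVar ω₂ lam β γ T) thouless :=
  Iff.rfl

/-- Read-back of the support item: `LightConeBondHeat` is the light-cone-window law of the same functional. -/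
theorem lightConeBondHeat_iff :
    LightConeBondHeat ↔
      ∀ ω₂ lam β γ : ℝ, 0 < ω₂ → 0 < lam → 0 < β → 0 < γ → ∀ T : ℝ, 0 < T →
        WindowLaw (bondHeatVar ω₂ lam β γ T) lightCone :=
  Iff.rfl

/-! ## §1 Junk audit: every junk default helps the prover, none helps the refuter -/

/-- If the variance functional vanished identically (the value every Bochner / interval-integral junk default in the
crux produces), the window law would hold trivially (`A = 0`).  So non-measurability / non-integrability can only
make (S) TRUE for the wrong reason, never false; the refuter has no junk lever.  (In the model `C_N` is honest:
jointly measurable kernel `pinnedChain_measurable_transitionKernel`, polynomial moments of `μ_T`.) -/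
theorem windowLaw_of_vanishing (V : ℕ → ℕ → ℝ → ℝ) (L : ℝ → ℕ → ℝ) (hV : ∀ N b t, V N b t = 0) :
    WindowLaw V L := by
  refine ⟨0, 1, one_pos, 2, fun N hN => ⟨0, by omega, fun t _ _ => ?_⟩⟩
  simp [hV]

/-- SHAPE LEMMA (prover information).  The physically expected form of the bond-heat variance of a diffusive open
chain — EW law plus Kubo–KDN saturation, `V_N(b_N,t) ≤ a√t + B·t/N` for `t ≥ 1` (`B ≈ 2T²·N G_N ≈ 2T²κ`) — gives the
Thouless-window law for EVERY `c > 0`, with `A = a + B√c`.  Hence the crossover at `t ≍ N²` is harmless and the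
window is not where (S) can fail; all difficulty is in the two N-uniform inputs `a` (diffusive spreading) and `B`
(Ohmic conductance). -/
theorem windowLaw_of_diffusive_ohmic (V : ℕ → ℕ → ℝ → ℝ) (b : ℕ → ℕ) (a B : ℝ) (hB : 0 ≤ B) (N₁ : ℕ)
    (hb : ∀ N : ℕ, N₁ ≤ N → b N + 1 < N)
    (hV : ∀ N : ℕ, N₁ ≤ N → ∀ t : ℝ, 1 ≤ t → V N (b N) t ≤ a * Real.sqrt t + B * t / N) :
    ∀ c : ℝ, 0 < c → ∃ N₀ : ℕ, ∀ N : ℕ, N₀ ≤ N → ∃ b' : ℕ, b' + 1 < N ∧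
      ∀ t : ℝ, 1 ≤ t → t ≤ thouless c N → V N b' t ≤ (a + B * Real.sqrt c) * Real.sqrt t := by
  intro c hc
  refine ⟨max N₁ 1, fun N hN => ⟨b N, hb N (le_trans (le_max_left _ _) hN), fun t ht htc => ?_⟩⟩
  have hN1 : N₁ ≤ N := le_trans (le_max_left _ _) hN
  have hN' : (0 : ℝ) < N := by exact_mod_cast (lt_of_lt_of_le Nat.one_pos (le_trans (le_max_right _ _) hN))
  have ht0 : 0 ≤ t := by linarith
  have hst : Real.sqrt t * Real.sqrt t = t := Real.mul_self_sqrt ht0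
  have h1 : Real.sqrt t ≤ Real.sqrt c * N := by
    rw [show Real.sqrt c * N = Real.sqrt (c * (N : ℝ) ^ 2) by
      rw [Real.sqrt_mul hc.le, Real.sqrt_sq hN'.le]]
    exact Real.sqrt_le_sqrt htc
  have h2 : B * t / N ≤ B * Real.sqrt c * Real.sqrt t := by
    rw [div_le_iff₀ hN']
    calc B * t = B * (Real.sqrt t * Real.sqrt t) := by rw [hst]
      _ ≤ B * (Real.sqrt t * (Real.sqrt c * N)) := by
          apply mul_le_mul_of_nonneg_left _ hB
          exact mul_le_mul_of_nonneg_left h1 (Real.sqrt_nonneg _)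
      _ = B * Real.sqrt c * Real.sqrt t * N := by ring
  calc V N (b N) t ≤ a * Real.sqrt t + B * t / N := hV N hN1 t ht
    _ ≤ a * Real.sqrt t + B * Real.sqrt c * Real.sqrt t := by linarith
    _ = (a + B * Real.sqrt c) * Real.sqrt t := by ring

/-! ## §2 Load-bearing analysis

Conventions: "`(S)` without `H`" is the crux with hypothesis `H` dropped or weakened; "false" means refuted in Lean
(possibly modulo a recorded `sorry`), "true" means provable in principle / holds in the model. -/

/-- (S) with the anharmonicity hypotheses weakened to `0 ≤ lam`, `0 ≤ β` (so the pinned HARMONIC chain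
`pinnedChain ω₂ 0 0 γ` is admitted). FALSE: `false_without_anharmonicity` (§5). -/
def WithoutAnharmonicity : Prop :=
  ∀ ω₂ lam β γ : ℝ, 0 < ω₂ → 0 ≤ lam → 0 ≤ β → 0 < γ → ∀ T : ℝ, 0 < T →
    WindowLaw (bondHeatVar ω₂ lam β γ T) thouless

/-- The Thouless-window law at the harmonic member `pinnedChain ω₂ 0 0 γ`, temperature `T`. -/
def HarmonicWindowLaw (ω₂ γ T : ℝ) : Prop := WindowLaw (bondHeatVar ω₂ 0 0 γ T) thouless

/-- `WithoutAnharmonicity` contains the harmonic member. -/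
theorem harmonicWindowLaw_of_withoutAnharmonicity (h : WithoutAnharmonicity) {ω₂ γ T : ℝ} (hω : 0 < ω₂)
    (hγ : 0 < γ) (hT : 0 < T) : HarmonicWindowLaw ω₂ γ T :=
  h ω₂ 0 0 γ hω le_rfl le_rfl hγ T hT

/-- LOAD-BEARING ANALYSIS (informal record; the formal items are `false_without_anharmonicity`, §3 and §5).

* `0 < lam ∧ 0 < β` — LOAD-BEARING.  At `lam = β = 0` the chain is the pinned harmonic crystal: phonons are
  ballistic, the single-bond heat `Q_t^(b)` of the INFINITE chain already has `Var ≍ t` (each mode transports its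
  energy at group velocity; no ¼-law), and in the open chain `V_N(b,t)/t → 2T²G_N^{harm}` with
  `G_N^{harm} → c_∞ > 0` (`HarmonicChainBallisticFlux_holds`, RLL/Nakazawa; KDN flat Green–Kubo identity
  `∫₀^∞ C_N(b,s)ds = T²G_N` for every bond, refuter g41-10's exact check).  Hence `V_N(b,cN²) ≍ cN² ≫ A√c N`:
  `¬ HarmonicWindowLaw` (§5, exact numbers from kit j007955).  Each of `0 < lam`, `0 < β` ALONE is expected NOT
  load-bearing for truth (pinned FPU-β `lam = 0 < β` and the φ⁴-type chain `β = 0 < lam` are both chaotic, pinned,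
  numerically diffusive), but `β > 0` is what the tree's existence/uniqueness theory (CEHR C5) uses.
* `0 < γ` — NOT load-bearing for truth, because of the `∃ b`: at `γ = 0` the kernel is the deterministic Hamiltonian
  flow, `d e_{N−1}/dt = j_{N−2}` exactly (symmetric `bondCurrent`, `e_{N−1} = p²/2 + U(q_{N−1}) + ½V(q_{N−1}−q_{N−2})`),
  so `V_N(N−2,t) = Var_{μ_T}(e_{N−1}∘Φ_t − e_{N−1}) ≤ 4 Var_{μ_T^N}(e_{N−1}) = O(1)` uniformly in `N, t` (Gibbs
  invariance of the flow + one-site Gibbs moments): the window law holds with `A = 4 sup_N Var(e_{N−1})`.  With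
  `γ > 0` the same boundary choice is exactly the lead's line (`b = 0`: `∫₀ᵗ j₀ = Q^L_t − Δe₀`), where the bath heat
  `Q^L_t` re-imports the bulk transport (`Var(Q^L_t) = 2γT²∫₀ᵗ(1−θ_N)`).  Informative, not a refutation: the crux
  requires `γ > 0`.
* `0 < ω₂` — NOT load-bearing physically (quartic pinning `lam > 0` alone breaks momentum conservation and confines);
  the tree's `pinnedChain_measurable_solMap` / `_continuous_chainFlow` lemmas assume `0 < ω₂`, so at `ω₂ = 0` the
  kernel might even be the documented junk zero kernel (then `V ≡ 0`, (S) true by `windowLaw_of_vanishing`).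
* `0 < T` — at `T ≤ 0`: `gibbsMeasure` is `volume.tilted(−H/T)`; for `T < 0` the density `e^{−H/T} = e^{+H/|T|}` is
  not integrable ⇒ Gibbs measure `0` ⇒ `C ≡ 0`, `V ≡ 0`, (S) junk-true; `T = 0`: `−H/0 = 0` in Lean ⇒ tilted by `0`
  ⇒ `volume.tilted 0 = 0` as Lebesgue is infinite ⇒ again `V ≡ 0`.  So `0 < T` is not load-bearing for truth either
  (dropping it adds only junk-true instances).
* ORDER OF QUANTIFIERS `∀ T ∃ A c N₀` — necessary: `A` cannot be uniform in `T` (as `T → ∞`, `V_N(b,1) ≈ ⟨j_b²⟩_T`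
  grows like `T²·(1 + O(√T))`; as `T → 0` the ballistic-to-diffusive crossover time `τ(T) → ∞`
  (`LowTemperatureWeakAnharmonicity`) forces `A(T) ≳ 2γT²E^{harm}√τ(T)` at the bath bond and `N₀(T) ≳ v·τ(T)`).
* `∃ b` (prover's choice) versus `∀ b` — not load-bearing physically (every bond of a diffusive chain obeys the EW
  law; the bath bond and the bulk bond differ only in constants), but it is what makes the `γ = 0` corner trivial and
  what the lead's line exploits (`b = 0`).
* WINDOW `[1, cN²]` — see §3: exactly the threshold of the route's transfer (cannot be lowered for the route's purpose)
  and maximal under an Ohmic floor (cannot be raised if Fourier's law holds). -/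
theorem loadBearing : True := trivial

/-! ## §3 Tightness of the window (sorry-free) -/

/-- The abstract transfer schema behind `TransferToBoundedResponse` / `TransferToNonBallistic`, with the bond-heat
window `[1, c·N^α]` as a parameter (temperature normalised to `T = 1`; `V N t` stands for `V_N(b_N,t)`, `G N` for
the conductance `G_N = D_N/(N−1) ≥ 0` of (★)(a), `K N ≥ 0` for the snapshot-irreversibility constant of (K)):
(S_α) ∧ (K) ∧ (★) ⇒ `N·G_N` bounded. -/
def TransferSchema (α : ℝ) : Prop :=
  ∀ (V : ℕ → ℝ → ℝ) (G K : ℕ → ℝ),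
    (∀ N, 0 ≤ G N) → (∀ N, 0 ≤ K N) → (∃ C : ℝ, ∀ N : ℕ, K N ≤ C * N) →
    (∃ A c : ℝ, 0 < c ∧ ∃ N₀ : ℕ, ∀ N : ℕ, N₀ ≤ N → ∀ t : ℝ, 1 ≤ t → t ≤ c * (N : ℝ) ^ α →
        V N t ≤ A * Real.sqrt t) →
    (∀ N : ℕ, ∀ t : ℝ, 0 < t → 2 * G N ^ 2 * t ^ 2 ≤ V N t * (G N * t + K N)) →
    BddAbove (Set.range fun N : ℕ => (N : ℝ) * G N)

/-- Below the Thouless exponent the schema fails: explicit saturating model with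
`G_N = N^{1/2 - 3α/4}`, `K_N = N`, `V_N(t) = 2G²t²/(Gt + K)` (so (★) is an equality),
which obeys the window law with `A = 2`, `c = 1` and has `N·G_N = N^{3(2-α)/4} → ∞`. -/
theorem not_transferSchema_of_lt_two {α : ℝ} (hα : α < 2) : ¬ TransferSchema α := by
  intro h
  -- the model
  set w : ℕ → ℝ := fun N => (N : ℝ) ^ (α / 4) with hw
  set G : ℕ → ℝ := fun N => if N = 0 then 0 else Real.sqrt N / w N ^ 3 with hG
  set K : ℕ → ℝ := fun N => (N : ℝ) with hK
  set V : ℕ → ℝ → ℝ := fun N t => if N = 0 then 0 else 2 * G N ^ 2 * t ^ 2 / (G N * t + K N) with hV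
  have hwpos : ∀ N : ℕ, N ≠ 0 → 0 < w N := fun N hN => by
    have : (0 : ℝ) < N := by exact_mod_cast Nat.pos_of_ne_zero hN
    exact Real.rpow_pos_of_pos this _
  have hGnn : ∀ N, 0 ≤ G N := fun N => by
    by_cases hN : N = 0
    · simp [hG, hN]
    · simp only [hG, hN, if_false]
      exact div_nonneg (Real.sqrt_nonneg _) (pow_nonneg (hwpos N hN).le 3)
  have hGpos : ∀ N : ℕ, N ≠ 0 → 0 < G N := fun N hN => by
    simp only [hG, hN, if_false]
    have : (0 : ℝ) < N := by exact_mod_cast Nat.pos_of_ne_zero hN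
    exact div_pos (Real.sqrt_pos.2 this) (pow_pos (hwpos N hN) 3)
  have hKnn : ∀ N, 0 ≤ K N := fun N => by simp [hK]
  have hKle : ∃ C : ℝ, ∀ N : ℕ, K N ≤ C * N := ⟨1, fun N => by simp [hK]⟩
  have hden : ∀ N : ℕ, N ≠ 0 → ∀ t : ℝ, 0 ≤ t → 0 < G N * t + K N := fun N hN t ht => by
    have : (0 : ℝ) < N := by exact_mod_cast Nat.pos_of_ne_zero hN
    have h1 : 0 ≤ G N * t := mul_nonneg (hGnn N) ht
    simp only [hK]; linarith
  -- (★) holds (with equality for N ≠ 0)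
  have hstar : ∀ N : ℕ, ∀ t : ℝ, 0 < t → 2 * G N ^ 2 * t ^ 2 ≤ V N t * (G N * t + K N) := by
    intro N t ht
    by_cases hN : N = 0
    · simp [hV, hG, hN]
    · simp only [hV, hN, if_false]
      rw [div_mul_cancel₀ _ (hden N hN t ht.le).ne']
  -- the window law with A = 2, c = 1, N₀ = 1
  have hwin : ∃ A c : ℝ, 0 < c ∧ ∃ N₀ : ℕ, ∀ N : ℕ, N₀ ≤ N → ∀ t : ℝ, 1 ≤ t →
      t ≤ c * (N : ℝ) ^ α → V N t ≤ A * Real.sqrt t := by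
    refine ⟨2, 1, one_pos, 1, fun N hN t ht htw => ?_⟩
    have hN0 : N ≠ 0 := by omega
    have hNpos : (0 : ℝ) < N := by exact_mod_cast Nat.pos_of_ne_zero hN0
    have ht0 : 0 < t := by linarith
    simp only [hV, hN0, if_false]
    -- V ≤ 2 G² t² / K
    have hKpos : 0 < K N := by simp only [hK]; exact hNpos
    have h1 : 2 * G N ^ 2 * t ^ 2 / (G N * t + K N) ≤ 2 * G N ^ 2 * t ^ 2 / K N := by
      apply div_le_div_of_nonneg_left (by positivity) hKpos
      have := mul_nonneg (hGnn N) ht0.le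
      linarith
    -- 2 G² t² / K = 2 t² / w⁶
    have hG2 : G N ^ 2 = (N : ℝ) / w N ^ 6 := by
      simp only [hG, hN0, if_false]
      rw [div_pow, Real.sq_sqrt hNpos.le]; ring
    have hw6 : 0 < w N ^ 6 := pow_pos (hwpos N hN0) 6
    have h2 : 2 * G N ^ 2 * t ^ 2 / K N = 2 * t ^ 2 / w N ^ 6 := by
      rw [hG2]; simp only [hK]; field_simp
    -- window: t ≤ N^α = (w N)^4, hence √t ≤ (w N)^2 and t² ≤ √t · w⁶
    have hw4 : (N : ℝ) ^ α = w N ^ 4 := by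
      simp only [hw]; rw [← Real.rpow_natCast, ← Real.rpow_mul hNpos.le]; norm_num
    rw [one_mul, hw4] at htw
    have hst : Real.sqrt t ≤ w N ^ 2 := by
      have : Real.sqrt (w N ^ 4) = w N ^ 2 := by
        rw [show w N ^ 4 = (w N ^ 2) ^ 2 by ring, Real.sqrt_sq (by positivity)]
      rw [← this]; exact Real.sqrt_le_sqrt htw
    have hs0 : 0 ≤ Real.sqrt t := Real.sqrt_nonneg t
    have ht2 : t ^ 2 ≤ Real.sqrt t * w N ^ 6 := by
      have e : t ^ 2 = Real.sqrt t * Real.sqrt t ^ 3 := by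
        have := Real.mul_self_sqrt ht0.le
        calc t ^ 2 = (Real.sqrt t * Real.sqrt t) ^ 2 := by rw [this]
          _ = Real.sqrt t * Real.sqrt t ^ 3 := by ring
      rw [e]
      have : Real.sqrt t ^ 3 ≤ (w N ^ 2) ^ 3 := pow_le_pow_left₀ hs0 hst 3
      calc Real.sqrt t * Real.sqrt t ^ 3 ≤ Real.sqrt t * (w N ^ 2) ^ 3 :=
            mul_le_mul_of_nonneg_left this hs0
        _ = Real.sqrt t * w N ^ 6 := by ring
    calc 2 * G N ^ 2 * t ^ 2 / (G N * t + K N) ≤ 2 * G N ^ 2 * t ^ 2 / K N := h1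
      _ = 2 * t ^ 2 / w N ^ 6 := h2
      _ ≤ 2 * (Real.sqrt t * w N ^ 6) / w N ^ 6 := by
          apply div_le_div_of_nonneg_right _ hw6.le; linarith
      _ = 2 * Real.sqrt t := by rw [mul_div_assoc, mul_div_cancel_right₀ _ hw6.ne']
  -- the conclusion fails: N · G N = N^{3(2-α)/4} is unbounded
  obtain ⟨B, hB⟩ := h V G K hGnn hKnn hKle hwin hstar
  have hNG : ∀ N : ℕ, N ≠ 0 → (N : ℝ) * G N = (N : ℝ) ^ (3 * (2 - α) / 4) := by
    intro N hN0
    have hNpos : (0 : ℝ) < N := by exact_mod_cast Nat.pos_of_ne_zero hN0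
    simp only [hG, hN0, if_false, hw]
    rw [Real.sqrt_eq_rpow, ← Real.rpow_natCast, ← Real.rpow_mul hNpos.le, mul_div_assoc']
    rw [show (N : ℝ) * (N : ℝ) ^ (1 / 2 : ℝ) = (N : ℝ) ^ (1 : ℝ) * (N : ℝ) ^ (1 / 2 : ℝ) by
      rw [Real.rpow_one], ← Real.rpow_add hNpos, ← Real.rpow_sub hNpos]
    congr 1
    push_cast
    ring
  have hexp : 0 < 3 * (2 - α) / 4 := by linarith
  have htend : Filter.Tendsto (fun N : ℕ => (N : ℝ) ^ (3 * (2 - α) / 4)) Filter.atTop Filter.atTop :=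
    (tendsto_rpow_atTop hexp).comp tendsto_natCast_atTop_atTop
  obtain ⟨N, hN⟩ := Filter.eventually_atTop.mp (htend.eventually_gt_atTop B)
  have hN1 : max N 1 ≠ 0 := by omega
  have h1 := hN (max N 1) (le_max_left _ _)
  have h2 : (max N 1 : ℕ) * G (max N 1) ≤ B := hB ⟨max N 1, rfl⟩
  rw [hNG _ hN1] at h2
  linarith

/-- At and above the Thouless exponent the schema holds (the route's `TransferToBoundedResponse`
arithmetic, abstractly): evaluate (★) at `t = cN²` with `K ≤ CN`, `V ≤ A√c·N`. -/
theorem transferSchema_of_two_le {α : ℝ} (hα : 2 ≤ α) : TransferSchema α := by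
  intro V G K hG hK hKC hwin hstar
  obtain ⟨C, hC⟩ := hKC
  obtain ⟨A, c, hc, N₀, hwin⟩ := hwin
  set A' : ℝ := max A 0 with hA'
  set C' : ℝ := max C 0 with hC'
  have hA'0 : 0 ≤ A' := le_max_right _ _
  have hC'0 : 0 ≤ C' := le_max_right _ _
  set P : ℝ := A' * Real.sqrt c * c with hP
  set Q : ℝ := A' * Real.sqrt c * C' with hQ
  have hP0 : 0 ≤ P := by positivity
  have hQ0 : 0 ≤ Q := by positivity
  set B : ℝ := max 1 ((P + Q) / (2 * c ^ 2)) with hB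
  set N₁ : ℕ := ⌈1 / c⌉₊ + 1 with hN₁
  set M : ℕ := max N₀ N₁ with hM
  -- the tail bound
  have key : ∀ N : ℕ, M ≤ N → (N : ℝ) * G N ≤ B := by
    intro N hMN
    have hN0N : N₀ ≤ N := le_trans (le_max_left _ _) hMN
    have hN1N : N₁ ≤ N := le_trans (le_max_right _ _) hMN
    have hNge1 : (1 : ℝ) ≤ N := by exact_mod_cast (show 1 ≤ N by omega)
    have hNpos : (0 : ℝ) < N := by linarith
    have hNc : 1 / c ≤ (N : ℝ) := by
      have h1 : (1 / c : ℝ) ≤ ⌈1 / c⌉₊ := Nat.le_ceil _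
      have h2 : ((⌈1 / c⌉₊ : ℕ) : ℝ) + 1 ≤ N := by exact_mod_cast hN1N
      linarith
    -- t := c N²
    set t : ℝ := c * (N : ℝ) ^ 2 with ht
    have ht1 : 1 ≤ t := by
      have : 1 ≤ c * (N : ℝ) := by
        rw [div_le_iff₀ hc] at hNc; linarith
      have hN2 : (N : ℝ) ≤ (N : ℝ) ^ 2 := by nlinarith
      calc (1 : ℝ) ≤ c * N := this
        _ ≤ c * (N : ℝ) ^ 2 := mul_le_mul_of_nonneg_left hN2 hc.le
    have ht0 : 0 < t := by linarith
    have htw : t ≤ c * (N : ℝ) ^ α := by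
      apply mul_le_mul_of_nonneg_left _ hc.le
      rw [show (N : ℝ) ^ 2 = (N : ℝ) ^ ((2 : ℕ) : ℝ) by rw [Real.rpow_natCast]]
      exact Real.rpow_le_rpow_of_exponent_le hNge1 (by exact_mod_cast hα)
    have hsqrt : Real.sqrt t = Real.sqrt c * N := by
      rw [ht, Real.sqrt_mul hc.le, Real.sqrt_sq hNpos.le]
    -- V ≤ A' √c N
    have hV : V N t ≤ A' * Real.sqrt c * N := by
      calc V N t ≤ A * Real.sqrt t := hwin N hN0N t ht1 htw
        _ ≤ A' * Real.sqrt t := mul_le_mul_of_nonneg_right (le_max_left _ _) (Real.sqrt_nonneg _)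
        _ = A' * Real.sqrt c * N := by rw [hsqrt]; ring
    -- K ≤ C' N
    have hKN : K N ≤ C' * N :=
      (hC N).trans (mul_le_mul_of_nonneg_right (le_max_left _ _) hNpos.le)
    have hfac : 0 ≤ G N * t + K N := by
      have := mul_nonneg (hG N) ht0.le; have := hK N; linarith
    -- (★) at t
    have h1 : 2 * G N ^ 2 * t ^ 2 ≤ A' * Real.sqrt c * N * (G N * t + C' * N) := by
      calc 2 * G N ^ 2 * t ^ 2 ≤ V N t * (G N * t + K N) := hstar N t ht0
        _ ≤ (A' * Real.sqrt c * N) * (G N * t + K N) := mul_le_mul_of_nonneg_right hV hfac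
        _ ≤ (A' * Real.sqrt c * N) * (G N * t + C' * N) := by
            apply mul_le_mul_of_nonneg_left _ (by positivity); linarith
    -- in terms of x = N G: 2 c² x² ≤ P x + Q
    set x : ℝ := (N : ℝ) * G N with hx
    have hx0 : 0 ≤ x := mul_nonneg hNpos.le (hG N)
    have h2 : 2 * c ^ 2 * x ^ 2 * (N : ℝ) ^ 2 ≤ (P * x + Q) * (N : ℝ) ^ 2 := by
      have e1 : 2 * G N ^ 2 * t ^ 2 = 2 * c ^ 2 * x ^ 2 * (N : ℝ) ^ 2 := by
        simp only [ht, hx]; ring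
      have e2 : A' * Real.sqrt c * N * (G N * t + C' * N) = (P * x + Q) * (N : ℝ) ^ 2 := by
        simp only [ht, hx, hP, hQ]; ring
      rw [← e1, ← e2]; exact h1
    have hN2pos : (0 : ℝ) < (N : ℝ) ^ 2 := by positivity
    have h3 : 2 * c ^ 2 * x ^ 2 ≤ P * x + Q := le_of_mul_le_mul_right h2 hN2pos
    -- conclude x ≤ B
    by_cases hx1 : x ≤ 1
    · exact hx1.trans (le_max_left _ _)
    · push Not at hx1
      have hc2 : 0 < 2 * c ^ 2 := by positivity
      have h4 : 2 * c ^ 2 * x ≤ P + Q := by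
        -- from 2c²x² ≤ Px + Q and x > 1: 2c²x·x ≤ P x + Q ≤ P x + Q x
        have hQx : Q ≤ Q * x := le_mul_of_one_le_right hQ0 hx1.le
        have h5 : 2 * c ^ 2 * x * x ≤ (P + Q) * x := by nlinarith
        exact le_of_mul_le_mul_right h5 (by linarith)
      have h6 : x ≤ (P + Q) / (2 * c ^ 2) := by
        rw [le_div_iff₀ hc2]; linarith
      exact h6.trans (le_max_right _ _)
  -- assemble a global bound
  refine ⟨B + ∑ k ∈ Finset.range M, (k : ℝ) * G k, ?_⟩
  rintro y ⟨N, rfl⟩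
  have hsum0 : 0 ≤ ∑ k ∈ Finset.range M, (k : ℝ) * G k :=
    Finset.sum_nonneg fun k _ => mul_nonneg (Nat.cast_nonneg k) (hG k)
  have hB1 : (1 : ℝ) ≤ B := le_max_left _ _
  by_cases hMN : M ≤ N
  · have := key N hMN
    show (N : ℝ) * G N ≤ B + _
    linarith
  · push Not at hMN
    have hmem : N ∈ Finset.range M := Finset.mem_range.2 hMN
    have hle : (N : ℝ) * G N ≤ ∑ k ∈ Finset.range M, (k : ℝ) * G k :=
      Finset.single_le_sum (f := fun k : ℕ => (k : ℝ) * G k)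
        (fun k _ => mul_nonneg (Nat.cast_nonneg k) (hG k)) hmem
    show (N : ℝ) * G N ≤ B + _
    linarith

/-- **The Thouless window is exactly the threshold of the transfer schema.** -/
theorem transferSchema_iff {α : ℝ} : TransferSchema α ↔ 2 ≤ α :=
  ⟨fun h => by
    by_contra hlt
    exact not_transferSchema_of_lt_two (lt_of_not_ge hlt) h, transferSchema_of_two_le⟩

/-- **Converse tightness: under an Ohmic floor the Thouless exponent is maximal.**  If the bond-heat variance has
an Ohmic floor `V_N(b,t) ≥ g·t/N` for `t ≥ N²` at every admissible bond (`g > 0`; this is the Kubo–KDN saturation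
`V_N ∼ 2T²G_N t` together with a conductance LOWER bound `G_N ≥ g/(2T²N)`, i.e. the positive half of Fourier's law,
cf. `PositiveOrInfiniteLimit` / `ConductanceLowerBound` on the ledger), then the window law with window `c·N³`
fails (likewise for any window `c·N^k`, `k > 2`).  So (S) cannot be strengthened in the window if Fourier's law is
true, and cannot be weakened in the window if it is to serve the route (`transferSchema_iff`). -/
theorem not_windowLaw_cube_of_ohmicFloor (V : ℕ → ℕ → ℝ → ℝ) {g : ℝ} (hg : 0 < g)
    (hfloor : ∃ N₁ : ℕ, ∀ N : ℕ, N₁ ≤ N → ∀ b : ℕ, b + 1 < N → ∀ t : ℝ, (N : ℝ) ^ 2 ≤ t →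
      g * t / N ≤ V N b t) :
    ¬ WindowLaw V (fun c N => c * (N : ℝ) ^ 3) := by
  rintro ⟨A, c, hc, N₀, hwin⟩
  obtain ⟨N₁, hfloor⟩ := hfloor
  -- R := (A √c / (g c))², pick N > max's
  set R : ℝ := (max A 0 * Real.sqrt c / (g * c)) ^ 2 with hR
  set N : ℕ := max (max N₀ N₁) (max (⌈1 / c⌉₊ + 1) (⌈R⌉₊ + 1)) with hNdef
  have hN0 : N₀ ≤ N := le_trans (le_max_left _ _) (le_max_left _ _)
  have hN1 : N₁ ≤ N := le_trans (le_max_right _ _) (le_max_left _ _)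
  have hNc' : ⌈1 / c⌉₊ + 1 ≤ N := le_trans (le_max_left _ _) (le_max_right _ _)
  have hNR' : ⌈R⌉₊ + 1 ≤ N := le_trans (le_max_right _ _) (le_max_right _ _)
  have hNpos : (0 : ℝ) < N := by exact_mod_cast (show 0 < N by omega)
  have hNc : 1 ≤ c * (N : ℝ) := by
    have h1 : (1 / c : ℝ) ≤ ⌈1 / c⌉₊ := Nat.le_ceil _
    have h2 : ((⌈1 / c⌉₊ : ℕ) : ℝ) + 1 ≤ N := by exact_mod_cast hNc'
    rw [div_le_iff₀ hc] at h1
    nlinarith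
  have hNR : R < N := by
    have h1 : R ≤ ⌈R⌉₊ := Nat.le_ceil _
    have h2 : ((⌈R⌉₊ : ℕ) : ℝ) + 1 ≤ N := by exact_mod_cast hNR'
    linarith
  obtain ⟨b, hb, hwin⟩ := hwin N hN0
  set t : ℝ := c * (N : ℝ) ^ 3 with ht
  have hN2t : (N : ℝ) ^ 2 ≤ t := by
    have : (N : ℝ) ^ 2 * 1 ≤ (N : ℝ) ^ 2 * (c * N) := mul_le_mul_of_nonneg_left hNc (by positivity)
    calc (N : ℝ) ^ 2 = (N : ℝ) ^ 2 * 1 := by ring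
      _ ≤ (N : ℝ) ^ 2 * (c * N) := this
      _ = t := by rw [ht]; ring
  have hNge1 : (1 : ℝ) ≤ N := by exact_mod_cast (show 1 ≤ N by omega)
  have ht1 : 1 ≤ t := le_trans (by nlinarith) hN2t
  have hup : V N b t ≤ A * Real.sqrt t := hwin t ht1 le_rfl
  have hlow : g * t / N ≤ V N b t := hfloor N hN1 b hb t hN2t
  -- √t = √c · N · √N
  have hsqrt : Real.sqrt t = Real.sqrt c * N * Real.sqrt N := by
    rw [ht, show c * (N : ℝ) ^ 3 = c * ((N : ℝ) ^ 2 * N) by ring, Real.sqrt_mul hc.le,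
      Real.sqrt_mul (by positivity), Real.sqrt_sq hNpos.le]; ring
  have hgt : g * t / N = g * c * (N : ℝ) ^ 2 := by
    rw [ht, div_eq_iff hNpos.ne']; ring
  -- g c N² ≤ A' √c N √N  ⇒ √N ≤ A' √c /(g c) ⇒ N ≤ R
  have hA' : A * Real.sqrt t ≤ max A 0 * Real.sqrt t :=
    mul_le_mul_of_nonneg_right (le_max_left _ _) (Real.sqrt_nonneg _)
  have hmain : g * c * (N : ℝ) ^ 2 ≤ max A 0 * Real.sqrt c * N * Real.sqrt N := by
    have := (hlow.trans hup).trans hA'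
    rw [hgt, hsqrt] at this; linarith
  have hsN : Real.sqrt (N : ℝ) ≤ max A 0 * Real.sqrt c / (g * c) := by
    rw [le_div_iff₀ (by positivity)]
    have hNs : (N : ℝ) = Real.sqrt N * Real.sqrt N := (Real.mul_self_sqrt hNpos.le).symm
    have h3 : g * c * (Real.sqrt N * Real.sqrt N) * N ≤ max A 0 * Real.sqrt c * Real.sqrt N * N := by
      calc g * c * (Real.sqrt N * Real.sqrt N) * N = g * c * (N : ℝ) ^ 2 := by rw [← hNs]; ring
        _ ≤ max A 0 * Real.sqrt c * N * Real.sqrt N := hmain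
        _ = max A 0 * Real.sqrt c * Real.sqrt N * N := by ring
    have h4 : g * c * (Real.sqrt N * Real.sqrt N) ≤ max A 0 * Real.sqrt c * Real.sqrt N :=
      le_of_mul_le_mul_right h3 hNpos
    have hspos : 0 < Real.sqrt (N : ℝ) := Real.sqrt_pos.2 hNpos
    have h5 : g * c * Real.sqrt N * Real.sqrt N ≤ max A 0 * Real.sqrt c * Real.sqrt N := by linarith [h4]
    have := le_of_mul_le_mul_right h5 hspos
    linarith
  have hNle : (N : ℝ) ≤ R := by
    have h0 : 0 ≤ Real.sqrt (N : ℝ) := Real.sqrt_nonneg _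
    calc (N : ℝ) = Real.sqrt N ^ 2 := by rw [Real.sq_sqrt hNpos.le]
      _ ≤ (max A 0 * Real.sqrt c / (g * c)) ^ 2 := pow_le_pow_left₀ h0 hsN 2
      _ = R := by rw [hR]
  linarith

/-! ## §4 Targets (the lead's stubs)

`payload.targets = []` at this cycle: no stub is assigned to this seat yet.  Pre-attack record below. -/

/-- PRE-ATTACK OF THE ACTIVE STUBS (skeleton sha 47d1b61f, lead prover-line-stmt-AtomisticToContinuum-9120-lean-0,
line `bath-bond-deficit-integral`, arena `b = 0`; signatures from `ledger workitem get stmt-…-9120`).  Notation: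
`θ₀ = p₀² − T`, `K_N(u) = ⟨θ₀, P_uθ₀⟩_{μ_T}`, `θ_N(s) = (γ/T²)∫₀ˢK_N`, `E_N = 1 − (γ/T²)∫_{(0,∞)}K_N`,
`e₀ = p₀²/2 + U(q₀) + ½V(q₁−q₀)`.

1. `stub_bathBondReduction` (fixed `N ≥ 2`, all `t ≥ 0`): `V_N(0,t) ≤ 4γT²∫₀ᵗ(1−θ_N) + 8E[e₀²]`.  TRUE in the model.
   Independent re-derivation (this seat): `dQ^L = −γθ₀dt + √(2γT)p₀dW`, `E M_t² = 2γT²t`; stationarity + momentum-flip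
   time reversal (`Q^L` odd, `θ₀` even) give `E[θ₀(z_s)Q^L_s] = −E[θ₀(z₀)Q^L_s] = +γ∫₀ˢK_N`, hence
   `E[θ₀(z_s)M_s] = 2γ∫₀ˢK_N` and `Var(Q^L_t) = 2γT²t − 2γ²∫₀ᵗ(t−u)K_N(u)du = 2γT²∫₀ᵗ(1−θ_N(s))ds` ✓; energy balance
   `ė₀|_H = ½V′(q₁−q₀)(p₀+p₁) = −j₀` ✓ so `∫₀ᵗj₀ = Q^L_t − Δe₀`; `V ≤ 2Var(Q^L_t) + 2E(Δe₀)² ≤ 4γT²∫(1−θ_N) + 8E[e₀²]` ✓.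
   Consistency: slope `2γT²` at `0⁺`, `2γT²E_N = 2T²G_N` at `∞` (KDN).  No cheap kill; junk: LHS and the inner
   integrals are honest once Gibbs invariance of the constructed kernels is proved (shared with stmt-12239).
2. `stub_gibbsMomentumFourthMoment`: `p₀⁴ ∈ L¹(μ_T^N)` and `∫p₀⁴dμ_T = 3T²`-bound.  TRUE WITH EQUALITY (the
   `p`-marginal of `volume.tilted(−H/T)` is the product Gaussian `N(0,T)^N` since `H = Σp²/2 + Φ(q)`,
   `hamiltonian_eq_kinetic_add_potential`): no slack, but `≤` is all that is claimed.  Size S–M (Fubini on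
   `(Fin N → ℝ) × (Fin N → ℝ)`, `integral_gaussian`-type lemmas).
3. `stub_gibbsPositionEighthMoment`: `∃ C ∀ N ≥ 2, E q₀⁸, E q₁⁸ ≤ C`.  TRUE (one-dimensional Gibbs state with convex
   even pinning; e.g. Brascamp–Lieb / log-concavity: `μ_T^N` is log-concave with `Hess ≥ diag(ω₂)/T` in `q`, so each
   `q_i` is sub-Gaussian with variance proxy `T/ω₂`, uniformly in `N` and `i` — a route to the stub that needs no
   transfer operator).  No kill.
4. `stub_ohmicFloor`: `∃ C₁ N₀ ∀ N ≥ N₀, E_N ≤ C₁/N`.  TRUE in the model iff bounded response at the contact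
   (`D_N = (N−1)γE_N`, ResponseIdentity) — open-problem calibre, shared with BoundaryEscapeDeficit; FALSE at the
   harmonic member (`E_N = 1/8` EXACTLY for N ≥ 16 at `(1,1,1)`, kit j007955; `D_N^{harm} = (N−1)/8`).  JUNK TRAP: `∫ u in Ioi 0, K_N u ∂volume` is a Bochner
   integral; if `K_N ∉ L¹((0,∞))` it is `0`, `E_N = 1`, and the stub is FALSE as typed for every `C₁` (take
   `N > C₁`).  In the model `K_N ∈ L¹` at each fixed `N`: `|K_N(u)| ≤ C e^{−cu}` from
   `pinnedChainSemigroup_exp_convergence` (CEHR Thm 2.13(3), PROVED in `LangevinChainHarris`) applied to `f = θ₀`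
   (continuous, `|θ₀| ≤ C_ϑe^{ϑH}`) and Gibbs = the invariant probability measure at `T_L = T_R = T` — so the lead
   must route the integrability through that theorem (its hypotheses `H2`, minorisation are the `_holds` chain of
   `CuneoEckmannHairerReyBellet2018_pinnedChain_holds`).
5. `stub_transientEW`: `∃ C₂ c>0 N₀ ∀ N ≥ N₀ ∀ t ∈ [1,cN²], ∫₀ᵗ(1 − θ_N(s) − E_N)ds ≤ C₂√t`.  TRUE in the model iff
   the EW ¼-law of the bath heat transient (the integrand is `(γ/T²)∫_s^∞K_N ≍ s^{−1/2}` before the Thouless time: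
   1-D return-to-the-contact tail); this is the N-uniform diffusive content of (S) at `b = 0` minus the Ohmic floor.
   Junk: if `K_N ∉ L¹` the integrand is `−θ_N(s)` and the claim reads `−(γ/T²)∫₀ᵗ(t−u)K_N ≤ C₂√t`, true because
   `2∫₀ᵗ(t−u)K_N = Var(∫₀ᵗθ₀) ≥ 0` (needs Gibbs invariance).  CALIBRATION CORRECTION (EXACT, this seat — local
   pure-Python Gaussian computation `harm_local.py`, `K_N(u) = 2T²(e^{Au})²_{p₀p₀}`, `(ω₂,γ,T) = (1,1,1)`, ds = 0.05,
   evidence file `harmonic_local_exact.md`): the line card's claim that `stub_transientEW` HOLDS at the harmonic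
   member is WRONG asymptotically.  The deficit `1 − θ_N(s)` drops from `1` to a PLATEAU `0.14825` within `s ≈ 10`
   (semi-infinite escape value; identical for N = 16, 48, 96 to 5 digits) and stays there until the first echo from
   the far bath at `s ≈ 2N/v_max ≈ 3.2N` (`v_max ≈ 0.62` for `ω₂ = 1`; N = 16: drop starts at s ≈ 50; N = 96: plateau
   intact at s = 300), after which it steps down over further echoes to `E_N → 0.125` (N = 16: 0.137 (s=60), 0.129
   (100), 0.1257 (200), 0.1245 (500), 0.1242 (2000)).  Hence the transient `1 − θ_N − E_N ≈ 0.0233` is ORDER ONE on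
   `[10, 3.2N]` and `∫₀ᵗ(1−θ_N−E_N) ≈ 1.2 + 0.0233·t` there: the ratio to `√t` at `t = 3N` is `0.277` (N=16), `0.44`
   (N=96), `≈ 0.04√N + 1.2/√(3N)` in general → exceeds any fixed `C₂` beyond `N ≈ (25·C₂)²` (C₂ = 1: N ≈ 600).  So BOTH
   N-uniform stubs (`ohmicFloor`: `E_N → 0.125 > 0`, and `transientEW`) fail at `lam = β = 0`, the second one
   invisibly below N ≈ 600 — the planner's N ≤ 8 calibration (j007496/j007530) could not detect it.  Both stubs carry
   anharmonic content; in the anharmonic chain at low `T` the same plateau persists up to the phonon mean free time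
   `τ(T)`, forcing `C₂(T) ≳ 0.02√τ(T)` (allowed: constants are per-`T`).  (Cross-checks: weak coupling `γ → 0` gives
   `E → 1/2` exactly — LLP's RLL formula `j → (γ/2)ΔT` — each mode being damped equally by both ends; the naive
   one-mode composition `E = p/(2−p)` with `p = 0.148` gives 0.080 ≠ 0.125, so the echo re-absorption is
   frequency-selective, but only the sign `p > E_∞` matters here.)  Cheapest falsifier of the stub for the ANHARMONIC
   chain: MD `W(t) − t·W′(t_max)`, `W = Var(Q^L_t)/(2γT²)` (kit j007947 prints it at `t = N²/16`, and `W/√t` along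
   the grid). -/
theorem stubsPreAttack : True := trivial

/-- **At the bath bond the Ohmic floor is NECESSARY** (information for the lead: `stub_ohmicFloor` cannot be
evaded by any `b = 0` line).  Abstractly: if the reverse reduction `2γT²·W_N(t) ≤ 2V_N(0,t) + 8σ²` holds
(`W_N(t) = ∫₀ᵗ(1−θ_N) = Var(Q^L_t)/(2γT²)`, from `Q^L_t = ∫₀ᵗj₀ + Δe₀`), the window law holds at `b = 0`, and the
transient is nonnegative (`E_N·t ≤ W_N(t)`, i.e. `1 − θ_N(s) ≥ E_N`: the growth rate of `Var(Q^L_t)` decreases to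
its KDN limit — a SIGN condition on the tail `∫_s^∞K_N`, automatic for reversible dynamics, plausible here), then
`E_N ≤ C₁/N` eventually with `C₁ = (|A|√c + 4|σ²|)/(γT²c)`.  So (S)|_{b=0} contains bounded response at the contact
(`D_N = (N−1)γE_N`) up to that sign — consistent with `HasBoundedResponse` being met head-on. -/
theorem ohmicFloor_necessary_at_bathBond (W V : ℕ → ℝ → ℝ) (E : ℕ → ℝ) {γ T A c σ2 : ℝ} (hγ : 0 < γ)
    (hT : 0 < T) (hc : 0 < c) (N₀ : ℕ)
    (hred : ∀ N : ℕ, ∀ t : ℝ, 0 ≤ t → 2 * γ * T ^ 2 * W N t ≤ 2 * V N t + 8 * σ2)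
    (hwin : ∀ N : ℕ, N₀ ≤ N → ∀ t : ℝ, 1 ≤ t → t ≤ c * (N : ℝ) ^ 2 → V N t ≤ A * Real.sqrt t)
    (hpos : ∀ N : ℕ, ∀ t : ℝ, 0 ≤ t → E N * t ≤ W N t) :
    ∃ C₁ : ℝ, ∃ N₁ : ℕ, ∀ N : ℕ, N₁ ≤ N → E N ≤ C₁ / N := by
  refine ⟨(|A| * Real.sqrt c + 4 * |σ2|) / (γ * T ^ 2 * c), max N₀ (⌈1 / c⌉₊ + 1), fun N hN => ?_⟩
  have hN0 : N₀ ≤ N := le_trans (le_max_left _ _) hN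
  have hNc' : ⌈1 / c⌉₊ + 1 ≤ N := le_trans (le_max_right _ _) hN
  have hNge1 : (1 : ℝ) ≤ N := by exact_mod_cast (show 1 ≤ N by omega)
  have hNpos : (0 : ℝ) < N := by linarith
  have hNc : 1 ≤ c * (N : ℝ) := by
    have h1 : (1 / c : ℝ) ≤ ⌈1 / c⌉₊ := Nat.le_ceil _
    have h2 : ((⌈1 / c⌉₊ : ℕ) : ℝ) + 1 ≤ N := by exact_mod_cast hNc'
    rw [div_le_iff₀ hc] at h1
    nlinarith
  set t : ℝ := c * (N : ℝ) ^ 2 with ht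
  have ht1 : 1 ≤ t := by
    have : c * (N : ℝ) * 1 ≤ c * N * N := mul_le_mul_of_nonneg_left hNge1 (by positivity)
    calc (1 : ℝ) ≤ c * N := hNc
      _ = c * N * 1 := by ring
      _ ≤ c * N * N := this
      _ = t := by rw [ht]; ring
  have ht0 : 0 ≤ t := by linarith
  have hsqrt : Real.sqrt t = Real.sqrt c * N := by
    rw [ht, Real.sqrt_mul hc.le, Real.sqrt_sq hNpos.le]
  -- chain: γT² E t ≤ γT² W ≤ V + 4σ² ≤ |A|√c N + 4|σ²|
  have h1 : E N * t ≤ W N t := hpos N t ht0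
  have h2 : 2 * γ * T ^ 2 * W N t ≤ 2 * V N t + 8 * σ2 := hred N t ht0
  have h3 : V N t ≤ |A| * Real.sqrt c * N := by
    calc V N t ≤ A * Real.sqrt t := hwin N hN0 t ht1 le_rfl
      _ ≤ |A| * Real.sqrt t := mul_le_mul_of_nonneg_right (le_abs_self A) (Real.sqrt_nonneg _)
      _ = |A| * Real.sqrt c * N := by rw [hsqrt]; ring
  have hσ : σ2 ≤ |σ2| * N := by
    calc σ2 ≤ |σ2| := le_abs_self σ2
      _ = |σ2| * 1 := by ring
      _ ≤ |σ2| * N := mul_le_mul_of_nonneg_left hNge1 (abs_nonneg _)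
  have hγT : 0 < γ * T ^ 2 := by positivity
  have h4 : γ * T ^ 2 * (E N * t) ≤ (|A| * Real.sqrt c + 4 * |σ2|) * N := by
    have := mul_le_mul_of_nonneg_left h1 hγT.le
    nlinarith
  -- divide: E N ≤ C₁ / N  ⟺  E N * N ≤ C₁ (N > 0); and E N * t = E N * c N² 
  have h5 : γ * T ^ 2 * c * (E N * N) * N ≤ (|A| * Real.sqrt c + 4 * |σ2|) * N := by
    calc γ * T ^ 2 * c * (E N * N) * N = γ * T ^ 2 * (E N * t) := by rw [ht]; ring
      _ ≤ (|A| * Real.sqrt c + 4 * |σ2|) * N := h4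
  have h6 : γ * T ^ 2 * c * (E N * N) ≤ |A| * Real.sqrt c + 4 * |σ2| := le_of_mul_le_mul_right h5 hNpos
  have hγTc : 0 < γ * T ^ 2 * c := by positivity
  rw [le_div_iff₀ hNpos, le_div_iff₀ hγTc]
  calc E N * N * (γ * T ^ 2 * c) = γ * T ^ 2 * c * (E N * N) := by ring
    _ ≤ |A| * Real.sqrt c + 4 * |σ2| := h6

/-! ## §5 Near-misses (the only `sorry`s of this file) -/

/-- **(S) is false at the harmonic member** (`lam = β = 0`; load-bearing anharmonicity).  For `pinnedChain ω₂ 0 0 γ`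
the equilibrium bond-heat variance grows LINEARLY from `t = O(1)` on.  EXACT Gaussian computation (Isserlis:
`C_N(b,s) = 2 tr(M_b G(s) M_b G(s)ᵀ)`, `G(s) = e^{As}·T diag(H⁻¹, I)`; this seat's local pure-Python run
`harm_local2.py`, `(ω₂,γ,T) = (1,1,1)`, ds = 0.05, N = 32 and 64 agreeing to 4 digits inside the light cone;
evidence `harmonic_local_exact.md`; kit j007955 extends to N = 256 with `E_N` by Lyapunov): bulk bond `b = N/2−1`:
`V/t = 0.344 (t=5), 0.367 (10), 0.380 (20), 0.3867 (40), 0.3900 (80), 0.3906 (100)` — a PLATEAU `V_∞(t) ≈ 0.390·t`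
(the infinite chain's ballistic single-bond heat variance) until the echo from the nearest bath at `t ≈ 1.6N`, then
`V/t` decreases slowly towards the KDN slope `2T²G_N = 0.25` (`∫₀ᵗC_N(b,·)`: 0.195 on the plateau → 0.137 at t = 200,
→ `T²G_N = 0.125`; bath bond `b = 0`: `V/t = 0.300` flat on `[5, 200]`, `∫₀ᵗC → 0.149 → 0.125`).  Consequently
`V/√t = 0.39√t` grows without bound inside the window (`2.45` at t = 40, `3.91` at 100, `4.94` at 200) and
`V_N(b,t) ≥ 0.25·t(1−o(1))` for all large `t`: `V_N(b, cN²) ≥ 0.25cN² > A√c·N` once `N > 4A/√c`, for EVERY bond —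
`¬ HarmonicWindowLaw 1 1 1`; other `(ω₂,γ,T)` scale alike (`V ∝ T²`).  OBSTRUCTION to a Lean proof: the tree has the NESS flux of the harmonic chain
(`HarmonicChainBallisticFlux_holds`) but no two-time Gaussian calculus for `OscillatorChain.transitionKernel` of the
linear SDE (law of `solMap` = Gaussian with covariance `e^{As}S`, Isserlis for quadratic observables, a lower bound
on `∫₀ᵗ(t−s)C`); tried: none of `LangevinChainKalman` / `HarmonicCrystalBallisticProofs` exposes `e^{As}`.
A proof would also settle the calibration claims of all three line cards. -/
theorem not_harmonicWindowLaw {ω₂ γ T : ℝ} (hω : 0 < ω₂) (hγ : 0 < γ) (hT : 0 < T) :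
    ¬ HarmonicWindowLaw ω₂ γ T := by
  sorry

/-- Hence anharmonicity is load-bearing: (S) with `0 ≤ lam`, `0 ≤ β` is false (modulo `not_harmonicWindowLaw`). -/
theorem false_without_anharmonicity : ¬ WithoutAnharmonicity := fun h =>
  not_harmonicWindowLaw one_pos one_pos one_pos (harmonicWindowLaw_of_withoutAnharmonicity h one_pos one_pos one_pos)

/-! ## §6 Numerics -/

/-- NUMERICS (kit jobs of this seat; `--workitem stmt-AtomisticToContinuum-9120`, summaries + sha256 manifests auto-attach;
full stdout tables attached as evidence `md_j007947_stdout.log`).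

**kit j007947 `cdisprove-9120-md-bondheat` (DONE, cmp-6, ≈ 27 min/config)** — BAOAB equilibrium MD, dt = 0.025, 16 replicas,
exact O-step heat bookkeeping, `∫j_b` from the energy balance `Φ_b = E_{>b} − Q^R_in`, overlapping-window increment variances
(relative error `≈ √(2t/(16·t_tot))`: 5 % at `t = t_tot/50`, 14 % at the largest lag `t_tot/6` — values beyond `t_tot/20` are
indicative only).  Validation: `E p₀² = T` and `E p₀⁴ = 3T²` to 0.3 %, `K_N(0) = 2T²`, bookkeeping drift `|ΔE| ≤ 0.3`
(T ≤ 1); the HARMONIC controls reproduce this seat's exact numbers (§5): bulk `V/t = 0.383–0.389` on `[27, 108]` (exact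
0.390), bath bond `0.303` (exact 0.300), `W′ → 0.12` (exact `E_∞ = 0.125`).
pinnedChain 1 1 1 1, bulk bond `b = N/2 − 1` (the other three bonds agree within 10 %):
```
 T    N   t_tot  | V/√t at t = N   N²/64  N²/16   N²/4 |  V/t at N²/16 | D_N ≈ (N−1)γ·W′(t_tot/50)  [late dW/dt]
 1    32   6e4   |          2.5    1.9    3.2     5.4  |    0.40       |   5.2
 1    64  1.2e5  |          3.4    3.4    5.1     9.1  |    0.32       |   8.5            [V/t → 0.250 at 2e4 = 4.9N²]
 1   128   2e5   |          4.2    4.9    8.0    15.3  |    0.25       |  15.1            [V/t min 0.240 at 0.24N²]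
 1   256  2.4e5  |          4.9    6.4   10.5    21.0  |    0.164      |  19.0  [0.0805 → 20.5; V/t plateau 0.162 on 0.07–0.6N²]
 1   512  2.4e5  |          5.6    7.9   13.1     —    |    0.10       |  29 (transient) [0.041 → 21; V/t 0.087 at 0.15N², falling]
 0.1  64  1.2e5  |  (×T²)   3.3    3.3    5.2     9.0  |    0.34·T²    |   9.0
 0.1 128   2e5   |  (×T²)   4.6    5.5    9.4    17    |    0.29·T²    |  17.2
 0.1 256  2.4e5  |  (×T²)   6.5    9.8   16      32    |    0.25·T²    |  30.4
 5    64  1.2e5  |  (×T²)   3.6    3.6    5.3     9.7  |    0.33·T²    |   9.8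
 5   128   2e5   |  (×T²)   4.1    4.6    7.4    13.6  |    0.23·T²    |  13.0
 harmonic 1 0 0 1, T = 1:  N = 64: 3.1  3.1  5.3  8.4 | 0.33 | 7.6 ;  N = 128: 4.4  6.1  8.8  14.6 | 0.27 | 14.2  (ballistic: D_N ∝ N)
```
READING.  (i) No anomaly: at `T = 1` the response `D_N ≈ N·G_N` (from `W′ = 1 − θ_N → E_N`, `D_N = (N−1)γE_N`, and
independently from the KDN plateau `V/t → 2T²G_N`) grows 5.2, 8.5, 15, 20, ≈ 21 for N = 32…512 — ballistic up to N ≈ 128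
(indeed ABOVE the harmonic chain's `0.12·N`, the anharmonic chain being stiffer: `⟨j_b²⟩ = 0.57` vs `0.28`) and SATURATING
between N = 256 and 512 at `κ(T=1) ≈ 21 ± 2` (crossover length `ℓ ≈ 100–150`).  So at these parameters the chain is
numerically Ohmic beyond N ≈ 500 — incidentally direct evidence for `HasBoundedResponse` / `stub_ohmicFloor`
(`N·E_N → ≈ 21`).  (ii) (S) itself: `V/√t` at fixed `t/N² = 1/16` grows 3.2, 5.1, 8.0, 10.5, 13.1 — per doubling ×1.59,
×1.57, ×1.31, ×1.25, decelerating exactly as the shape `V ≈ a√t + 2T²G_N t` (§1 `windowLaw_of_diffusive_ohmic`)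
predicts: `V/√t|_{t=cN²} → a + 2√c·κ ≈ 3 + 11 = 14` for `c = 1/16` (N = 512 fit: `V ≈ 3.0√t + 0.084t` within 6 % on
`[300, 14000]`).  The EW constant is SMALL against the Ohmic term (`2κ/a ≈ 14 ≫ 4`), which is why the local log–log slopes
on `[N, N²/16]` read 0.74–0.84 instead of ½: the pure `√t` regime `[ℓ²/D, (a/2G_N)²]` is short at accessible N.  Best
current constants for provers at `(1,1,1,1), T = 1`: `A(c = 1/16) ≈ 14–15`, `A(c = 1/4) ≈ 26`, `N₀ ≈ 500`.
(iii) Temperature: `V/T²` is nearly `T`-independent at short times; the crossover length grows as `T ↓` (`T = 0.1`: `D_N`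
= 9, 17, 30 still linear at N = 256 — ballistic, `ℓ(0.1) ≫ 256`) and shrinks as `T ↑` (`T = 5`: 9.8, 13 — turning over by
N = 128), the `LowTemperatureWeakAnharmonicity` pattern; nothing superdiffusive.  (iv) The bath-bond objects of the lead's
line: `W = Var(Q^L_t)/(2γT²)` has `W/√t` at `t = N²/16` = 4.4 (128), 5.8 (256), 7.0 (512), approaching `w + N E_N√c ≈ 2 + 5`
likewise; the transient `W − tE_N` is not resolvable from these runs (an error `δE = 0.005` shifts it by `80` at `t = 16384`)
— a dedicated estimate needs `E_N` from a much longer run or from the NESS current directly.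
DECISION: the pre-registered kill signature (bulk-bond slope ≈ 1 persisting on `[N, N²/16]` with `V/√t|_{N²/16}` growing ∝ N)
is NOT observed: growth per doubling fell from 1.59 to 1.25 while `D_N` saturated.  (S) is numerically SUPPORTED at T = 1;
at `T = 0.1` the asymptotic regime is out of reach (N₀(0.1) ≫ 256), as (S) permits.

**kit j007955 `cdisprove-9120-harmonic-exact`** (exact Gaussian linear algebra at `lam = β = 0`, `(ω₂,γ,T) = (1,1,1)`,
`E_N` and `∫₀^∞C_b` by Lyapunov equations, NESS `G_N` at `δ = 10⁻³`; N = 2…128 reported, N = 256 running at this version):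
EXACT IDENTITIES confirmed to `10⁻¹⁰`: (a) the flat Kubo–KDN identity `∫₀^∞ C_N(b,s)ds = T²G_N` for EVERY bond `b`
(ratio `1.0000000000 ± 4·10⁻¹⁰`, N = 2…128, bath and bulk bonds); (b) the ResponseIdentity `γE_N = G_N` (ratio
`1 ± 4·10⁻¹⁰`); (c) `E_N`: `1/6` (N=2), `0.136364 = 3/22` (3), `0.127907` (4), `0.125011` (8), `0.125000` (16, 32, 64, 128)
— the harmonic escape deficit is EXACTLY `1/8` from N = 16 on, so `D_N^{harm} = (N−1)/8` (RLL ballistic law with an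
explicit constant at these parameters).  Tables (N = 128, ds = 0.05): deficit plateau `1 − θ_N = 0.14825` on `[20, 256]`,
`0.1363 (512)`, `0.1276 (1024)`, `0.1253 (2048)`, `0.1243 (8192)`; bulk bond `V/t = 0.3907 (100)`, `0.3921 (200)`,
`0.2921 (1000)`, `0.2604 (4096)`, `0.2551 (8192 = N²/2)` → `0.25`; bath bond `0.2994 → 0.2547`; `∫transient/√t = 0.422`
at `t = 2N`, `0.526` at `4N` — all identical to the local runs of §4–§5 and to the MD controls within MD error.
Smoke runs j007819 / j007828: pipeline validation only. -/
theorem numerics : True := trivial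

/-! ## §7 Why it resists -/

/-- WHY (S) RESISTS.  (1) Formally: honest objects, junk only in the prover's favour (§1), quantifiers in the right
order (§2), window exactly at the transfer threshold and at the Ohmic ceiling (§3).  (2) Physically: (S) ⟺ (EW ¼-law
of equilibrium energy spreading up to the Thouless time) ∧ (Ohmic `G_N = O(1/N)`, via `V(cN²) ≥ 2T²G_N·cN² − o(N)`
and the flat KDN identity `∫₀^∞C_N(b,·) = T²G_N`) — i.e. it CONTAINS bounded response (barrier `HasBoundedResponse`
met head-on, as the route declares) and is implied by normal heat diffusion; for a pinned chain with quartic pinning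
AND quartic coupling (momentum not conserved, gapped phonons, non-integrable, chaotic at every `T > 0`) every
numerical study reports normal conductivity (φ⁴ / on-site potentials: Hu–Li–Zhao PRE 57, 2992 (1998)
doi:10.1103/physreve.57.2992 and PRE 61, 3828 (2000) doi:10.1103/physreve.61.3828; Savin–Gendelman PRE 67, 041205 (2003)
doi:10.1103/physreve.67.041205; Aoki–Kusnezov 2000; BLR2000 §10 item 1 as quoted in `FouriersLaw.lean`; Lepri–Livi–Politi
2003 §6; Dhar 2008 §5 — metadata-level citations, `lit` full-text services were degraded during this cycle), and this
seat's own MD (§6) sees the conductance saturate at N ≈ 500 for T = 1, with finite-size crossovers governed by the phonon mean free path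
`ℓ(T)` — absorbed by `N₀(T)`, `A(T)`.  A substantive kill therefore needs an anomalous-transport MECHANISM for a
momentum-NON-conserving 1-D chain; none is catalogued (`FPUBetaKineticAnomaly*` is for the unpinned chain and is
excluded by `0 < ω₂, 0 < lam`; `MazurBoundBallisticOpenChain` needs a conserved charge overlapping `j_b`, none
exists for `lam, β > 0`; `StrongPinningBreathers` concern slow relaxation of localised high-energy excitations,
which DEPRESSES transport and would at most enlarge `N₀`, not break `√t`).  (3) What would change the verdict: MD
bulk-bond `V/√t` growing like `t^{1/2}` (slope 1) through `[N, N²/16]` at N = 512, T = 1 (kit j007947), or a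
theorem exhibiting a hidden quasi-conserved quantity of `pinnedChain` with `O(1)` overlap with `j_b`. -/
theorem whyItResists : True := trivial

end Summit.AtomisticToContinuum.FouriersLaw.Cruxes.SubdiffusiveBondHeat.Disproof
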